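import Mathlib
import Summits.MatrixMultiplication.MatrixMultiplication.Theses.FourierTwoFamiliesModP

/-!
# `PrimeTwoFamilies → cyclic ladders` — stub `cyclicLadder_of_primeTwoFamilies` (siege k17, Mathlib API route)

Crux `PrimeTwoFamilies` (stmt-MatrixMultiplication-14308, route `FourierTwoFamiliesModP`; CKSU 2005
Conj. 4.7 with prime cyclic hosts).  Line `Sketch` (Cruxes/PrimeTwoFamilies/Lines/Sketch.lean) reads the
crux through the CYCLIC LADDER CONJECTURE: for every `ε > 0` and arbitrarily large `m`, an ordered escape
ladder in `ℤ/m` — (i) every class `X c ⊕ Y c` direct; (ii) for classes `p < q`, every lower cross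
difference `y' - x'` (`x' ∈ X p`, `y' ∈ Y q`) avoids every diagonal difference `y - x` (`x ∈ X c`,
`y ∈ Y c`) — with `r ≥ m^{1/2-ε}` classes of co-volume `|X c| |Y c| ≥ m^{1-ε}`.

This file proves the registered stub `cyclicLadder_of_primeTwoFamilies` (the converse direction
crux ⇒ ladders) in a self-contained way, using only Mathlib and the route statement:

* an SDPP witness `(A i, B i)_{i<n}` in `ℤ/p` of the slice `δ := min ε 1` is a ladder in `ℤ/p` with
  `m := p`, `r := n` — clause (X) at `(i, j, k) = (p, c, q)` is exactly (ii);
* packing `|A i| |B i| ≤ p` (the sum map `A i × B i → ℤ/p` is injective by (W);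
  `Finset.card_le_card_of_injOn`) gives `m₀ ≤ n ≤ n^{2-δ} ≤ |A i| |B i| ≤ p`;
* the exponents: from `p ≤ n^{2+δ}` and `δ ≤ ε`, `δ ≤ 1`, monotonicity of `Real.rpow` in the base
  and in the exponent gives `p^{1/2-ε} ≤ n^{(2+δ)(1/2-ε)} ≤ n` and `p^{1-ε} ≤ n^{(2+δ)(1-ε)} ≤ n^{2-δ}`.

An independent proof of the same statement (via `p^{1/(2+δ)} ≤ n`) is
`…Theorems.PrimeTwoFamilies.LadderLift.cyclicLadder_of_primeTwoFamilies`.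
-/

-- single-conjunct summit: the mandated namespace repeats `MatrixMultiplication` (summit = sub-problem).
set_option linter.dupNamespace false

namespace Summit.MatrixMultiplication.MatrixMultiplication.Theorems.PrimeTwoFamilies.SiegeK17

open Finset
open Summit.MatrixMultiplication.MatrixMultiplication.Theses

/-- Packing of a direct pair: if `A ⊕ B` is direct in `ZMod p` (clause (W)), then `|A| |B| ≤ p`,
because `(a, b) ↦ a + b` is injective on `A ×ˢ B`. -/
theorem card_mul_card_le_of_direct {p : ℕ} [NeZero p] (A B : Finset (ZMod p))
    (hW : ∀ a ∈ A, ∀ a' ∈ A, ∀ b ∈ B, ∀ b' ∈ B, (a - a') + (b - b') = 0 → a = a' ∧ b = b') :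
    A.card * B.card ≤ p := by
  have hinj : Set.InjOn (fun ab : ZMod p × ZMod p => ab.1 + ab.2) ↑(A ×ˢ B) := by
    rintro ⟨a, b⟩ hab ⟨a', b'⟩ hab' h
    simp only [coe_product, Set.mem_prod, mem_coe] at hab hab'
    have h' : a + b = a' + b' := h
    obtain ⟨rfl, rfl⟩ := hW a hab.1 a' hab'.1 b hab.2 b' hab'.2 (by linear_combination h')
    rfl
  calc A.card * B.card = (A ×ˢ B).card := (card_product _ _).symm
    _ ≤ (univ : Finset (ZMod p)).card :=
        card_le_card_of_injOn _ (fun _ _ => mem_coe.2 (mem_univ _)) hinj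
    _ = p := by rw [card_univ, ZMod.card]

/-- Exponent bookkeeping: for `0 < δ ≤ ε`, `δ ≤ 1`, `1 ≤ n` and `0 ≤ P ≤ n^{2+δ}` one has
`P^{1/2-ε} ≤ n` and `P^{1-ε} ≤ n^{2-δ}` (base monotonicity of `rpow`, then `(2+δ)(1/2-ε) ≤ 1` and
`(2+δ)(1-ε) ≤ 2-δ`; the cases of a negative exponent are trivial since then `P^{·} ≤ 1`). -/
theorem exponents {ε δ : ℝ} (hδ : 0 < δ) (hδε : δ ≤ ε) (hδ1 : δ ≤ 1) {P : ℝ} {n : ℕ}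
    (hP1 : 1 ≤ P) (hn : 1 ≤ n) (hPn : P ≤ (n : ℝ) ^ (2 + δ)) :
    P ^ (1 / 2 - ε) ≤ (n : ℝ) ∧ P ^ (1 - ε) ≤ (n : ℝ) ^ (2 - δ) := by
  have hP0 : 0 ≤ P := zero_le_one.trans hP1
  have hn0 : (0 : ℝ) ≤ n := Nat.cast_nonneg n
  have hn1 : (1 : ℝ) ≤ n := by exact_mod_cast hn
  refine ⟨?_, ?_⟩
  · by_cases ht : 0 ≤ 1 / 2 - ε
    · calc P ^ (1 / 2 - ε) ≤ ((n : ℝ) ^ (2 + δ)) ^ (1 / 2 - ε) := Real.rpow_le_rpow hP0 hPn ht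
        _ = (n : ℝ) ^ ((2 + δ) * (1 / 2 - ε)) := (Real.rpow_mul hn0 _ _).symm
        _ ≤ (n : ℝ) ^ (1 : ℝ) :=
          Real.rpow_le_rpow_of_exponent_le hn1
            (by nlinarith [mul_nonneg (sub_nonneg.2 hδε) ht, sq_nonneg ε])
        _ = n := Real.rpow_one _
    · exact (Real.rpow_le_one_of_one_le_of_nonpos hP1 (le_of_not_ge ht)).trans hn1
  · by_cases ht : 0 ≤ 1 - ε
    · calc P ^ (1 - ε) ≤ ((n : ℝ) ^ (2 + δ)) ^ (1 - ε) := Real.rpow_le_rpow hP0 hPn ht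
        _ = (n : ℝ) ^ ((2 + δ) * (1 - ε)) := (Real.rpow_mul hn0 _ _).symm
        _ ≤ (n : ℝ) ^ (2 - δ) :=
          Real.rpow_le_rpow_of_exponent_le hn1
            (by nlinarith [mul_nonneg hδ.le (hδ.le.trans hδε)])
    · exact (Real.rpow_le_one_of_one_le_of_nonpos hP1 (le_of_not_ge ht)).trans
        (Real.one_le_rpow hn1 (by linarith))

/-- **Stub `cyclicLadder_of_primeTwoFamilies`** (crux ⇒ cyclic ladder conjecture, clauses inlined):
`PrimeTwoFamilies` gives, for every `ε > 0` and `m₀`, a modulus `m ≥ m₀` (a prime) and `r` classes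
`(X c, Y c)` in `ZMod m` with (i) every class direct, (ii) lower cross differences (`p < q`) avoiding
all diagonal differences, `m^{1/2-ε} ≤ r`, and co-volumes `m^{1-ε} ≤ |X c| |Y c|`.  Proof: an SDPP
witness `(A i, B i)_{i<n}`, `n ≥ m₀ + 1`, of the slice `δ := min ε 1` in `ℤ/p` is such a ladder with
`m := p`, `r := n`: clause (X) at `(i, j, k) = (p, c, q)` is (ii); `m₀ ≤ n ≤ n^{2-δ} ≤ |A 0| |B 0| ≤ p`
(`card_mul_card_le_of_direct`); and the exponents are `exponents` applied to `p ≤ n^{2+δ}`. -/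
theorem cyclicLadder_of_primeTwoFamilies (hT : FourierTwoFamiliesModP.PrimeTwoFamilies) :
    ∀ ε : ℝ, 0 < ε → ∀ m₀ : ℕ, ∃ m ≥ m₀, ∃ r : ℕ, ∃ X Y : Fin r → Finset (ZMod m),
      ((∀ c : Fin r, ∀ x ∈ X c, ∀ x' ∈ X c, ∀ y ∈ Y c, ∀ y' ∈ Y c,
          (x - x') + (y - y') = 0 → x = x' ∧ y = y') ∧
        (∀ c p q : Fin r, p < q → ∀ x ∈ X c, ∀ y ∈ Y c, ∀ x' ∈ X p, ∀ y' ∈ Y q,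
          y - x ≠ y' - x')) ∧
      (m : ℝ) ^ (1 / 2 - ε) ≤ (r : ℝ) ∧
      ∀ c : Fin r, (m : ℝ) ^ (1 - ε) ≤ (((X c).card * (Y c).card : ℕ) : ℝ) := by
  intro ε hε m₀
  have hδ : 0 < min ε 1 := lt_min hε one_pos
  have hδ1 : min ε 1 ≤ 1 := min_le_right _ _
  obtain ⟨n, hn, p, hp, A, B, hW, hX, hpn, hAB⟩ := hT (min ε 1) hδ (m₀ + 1)
  haveI : NeZero p := ⟨hp.ne_zero⟩
  have hn1 : 1 ≤ n := le_of_add_le_right hn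
  have hn1' : (1 : ℝ) ≤ n := by exact_mod_cast hn1
  -- `m₀ ≤ p`: `m₀ ≤ n ≤ n^{2-δ} ≤ |A i₀| |B i₀| ≤ p`
  have i₀ : Fin n := ⟨0, hn1⟩
  have hm₀ : m₀ ≤ p := by
    have h1 : (n : ℝ) ≤ (n : ℝ) ^ (2 - min ε 1) := by
      calc (n : ℝ) = (n : ℝ) ^ (1 : ℝ) := (Real.rpow_one _).symm
        _ ≤ (n : ℝ) ^ (2 - min ε 1) := Real.rpow_le_rpow_of_exponent_le hn1' (by linarith)
    have h2 : (n : ℝ) ≤ (p : ℝ) :=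
      (h1.trans (hAB i₀)).trans (by exact_mod_cast card_mul_card_le_of_direct (A i₀) (B i₀) (hW i₀))
    have h3 : n ≤ p := by exact_mod_cast h2
    omega
  obtain ⟨hr, hcov⟩ :=
    exponents hδ (min_le_left ε 1) hδ1 (by exact_mod_cast hp.one_lt.le) hn1 hpn
  refine ⟨p, hm₀, n, A, B, ⟨hW, ?_⟩, hr, fun c => hcov.trans (hAB c)⟩
  -- (ii) is clause (X) at `(i, j, k) = (p', c, q)`
  intro c p' q hpq x hx y hy x' hx' y' hy' heq
  refine absurd (hX p' c q x' hx' x hx y hy y' hy' ?_) (Fin.ne_of_lt hpq)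
  linear_combination heq

end Summit.MatrixMultiplication.MatrixMultiplication.Theorems.PrimeTwoFamilies.SiegeK17
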